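import Summits.QuantumFields.QCD.Theorems.HeatSlicedQuarksRobustYangMillsHandoverStubMassDerivativeOfUpdate
import Summits.QuantumFields.QCD.Theorems.HeatSlicedQuarksRobustYangMillsHandoverStubFermiBoltzmannUpdate

/-!
# Item stmt-QuantumFields-8909 `QuarkMassMonotone.MassDerivativeIdentity` — the Feynman–Hellmann identity in the quark mass

The finite-torus identity `∂_{m_f}⟨A⟩_{β,2S+1,m} = −(⟨A·Σ_f⟩ − ⟨A⟩⟨Σ_f⟩)`, `Σ_f = Σ_{x,a,α} ψ̄_{f,x,a,α}ψ_{f,x,a,α}`, for the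
tree's honest signed functional `qcdTorusExpect` (hypothesis: the fermionic partition function is non-zero), composed from the
two halves landed on crux stmt-QuantumFields-8892 (line `pin-the-infimum`, lead c15): the Grassmann identity
`e^{−ψ̄D(m[f↦μ])ψ} = e^{−ψ̄D(m)ψ} e^{−(μ−m_f)Σ_f}` (`stub_fermiBoltzmann_update`, p155452) and the calculus half — polynomial
expansion of the nilpotent exponential, coefficient-regular integrability, quotient rule (`stub_massDerivativeIdentity_of_update`,
p155680).  It is the engine's first lemma of route `QuarkMassMonotone` (card P2) and the finite-`(β,S)` identity behind the
sigma-term bound `stub_sigmaTermBound` of line `pin-the-infimum`.  References: Montvay–Münster, *Quantum Fields on a Lattice*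
§4.1 (4.14)–(4.17) [MontvayMunster1994]; Feynman–Hellmann.
-/

namespace Summit.QuantumFields.QCD.Theorems

/-- **Item stmt-QuantumFields-8909, `QuarkMassMonotone.MassDerivativeIdentity`** (Feynman–Hellmann in the bare quark mass on
the finite torus): for every `N_f, β, S`, bare tuple `m`, flavour `f`, gauge-invariant local observable `A` and placement `v`,
if the fermionic partition function on the torus of side `2S+1` is non-zero then `μ ↦ ⟨A⟩_{β,2S+1,m[f↦μ]}` has derivative
`−(⟨A·Σ_f⟩ − ⟨A⟩⟨Σ_f⟩)` at `μ = m_f`. [cite: MontvayMunster1994, §4.1 (4.14)–(4.17)] -/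
theorem massDerivativeIdentity_proof : Summit.QuantumFields.QCD.Theses.QuarkMassMonotone.MassDerivativeIdentity :=
  Summit.QuantumFields.QCD.Cruxes.RobustYangMillsHandover.PinTheInfimum.stub_massDerivativeIdentity_of_update
    Summit.QuantumFields.QCD.Cruxes.RobustYangMillsHandover.PinTheInfimum.stub_fermiBoltzmann_update

end Summit.QuantumFields.QCD.Theorems
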